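import Summits.BirchSwinnertonDyer.Rank1Residual.JET.CarrierReadingRecordsKit
import Summits.BirchSwinnertonDyer.BirchSwinnertonDyer.Theorems.Rank1ResidualJetCarrierShaKernelSwap
import HarnessLib

/-!
# T1 JET (cell `bsd-jet`): the register ROW KITS re-keyed to NAMED PRINT ONLY — `bsdp_of_jetRow{A5,B5}_tam_min`
# with the reading binder `hJ`, McCallum Cor. 5.6 `hMcU`, McCallum 5.2, `hrec`, `hD36`, `hlev` all FED BY NAME;
# displayed: {Poitou–Tate for Selmer structures, F1, Gross 3.7 (2), Kolyvagin, GZK, modularity} + ONE sample row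

HONEST FRAMING (programme file `BSD-LIT2PART-PROGRAMME-v1.md` §HONESTY, verbatim): «no tranche here
proves BSD; ARM L moves the LITERAL column of an r ≤ 1 census into the kernel-proved-modulo-named-print
column; ARM P changes what «named print» is worth.» THEOREMS ONLY (seat `bsd-jet-pv-2`, session g7;
`--supports stmt-BirchSwinnertonDyer-14418`, helper); nothing is booked by this file (bookings are referee
A's; the JET@p∣N rows of record stand on the documentary strikes R409/R466/R516–R518); 0 classes move.

WHAT. The by-name JET rows (`JET/JetDocstrike{A,B,Datum}Records*.lean`, `JetD1IndexRecords*`, …) close a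
cell `(label, p)` through a ROW KIT of `JET/CarrierReadingRecordsKit.lean` — road S `bsdp_of_jetRowA5_tam_min`
(bucket A, `p ≥ 5`: minimality, three Serre witnesses ⇒ `ρ̄_{E,p}` onto, one `TamLocal` certificate, all IN
THE KERNEL) and `bsdp_of_jetRowB5_tam_min` (bucket B, `p ≥ 5` multiplicative) — which display the class-free
binders {`hJ` (READING K1/K3), `hMcU` (McCallum Cor. 5.6), `hGZK`, `hKo`, `hrec`, `hD36`, `hlev`}. This file
gives the two kits' TWINS `…_of_swapLiterature` with the SAME numeric front-end (copied verbatim) and the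
consumer replaced by `JET.bsdp_of_carrier{Ne_level_of_five_le,Mult_level_of_surj}Certificate…_of_swapLiterature`
(`Rank1ResidualJetCarrierShaKernelSwap`, p565138): displayed class-free binders = {`hPT` (∀ K), `hF1`, `h372`,
`hGZK`, `hKo` (∀), `hmod`} — Poitou–Tate for Selmer structures, [GZ86 III (3.1)] ∕ Gross §6, Gross 3.7 (2),
GZK, Kolyvagin (Gross Thm. 1.3), modularity — NO reading binder, NO McCallum 5.2 / Cor. 5.6, NO Shimura /
Darmon / Carayol binder. §3 re-derives ONE landed sample row (`JET.bsdpJ_127050cx1_11`,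
`JetDocstrikeARecords01`, record arguments verbatim) through the twin, as the desks' parse sample. The other
kits (`A3F`, `B3`, `CarrierAdd_three_of_frobenius`, `CarrierMult_of_ram`, …) re-key the same way (their
consumers' `_of_swapLiterature` level forms exist: `…CarrierShaKernelSwap` §2). References:
[cite: Jetchev2008, Thm. 1.4, Cor. 1.5 (p. 812)] [cite: Serre1972, §2.8 Prop. 19] [cite: SilvermanATAEC1994, IV.9.4]
[cite: GrossLMS1991, Thm. 1.3, Prop. 3.7 (2)] [cite: MilneADT2006, Ch. I, Thm. 4.10(b)]. Design: no definitions.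
Axioms: `propext`, `Classical.choice`, `Quot.sound`.
-/

set_option autoImplicit false

noncomputable section

open scoped Classical

open WeierstrassCurve Literature.NumberTheory.EllipticCurves
  Literature.NumberTheory.EllipticCurves.ModularForms Literature.NumberTheory.GaloisCohomology
  Literature.NumberTheory.EllipticCurves.Rank1Residual
  Literature.NumberTheory.EllipticCurves.Rank1Residual.Typed
  Literature.NumberTheory.EllipticCurves.Rank1Residual.X11RankOneCertificates
  Summit.BirchSwinnertonDyer.BirchSwinnertonDyer.Rank1Residual
  Summit.BirchSwinnertonDyer.BirchSwinnertonDyer.Rank1Residual.IntModel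
  Summit.BirchSwinnertonDyer.BirchSwinnertonDyer.Rank1Residual.X11RankOne
  Summit.BirchSwinnertonDyer.BirchSwinnertonDyer.Rank2Observatory.Tam
  Summit.BirchSwinnertonDyer.Rank1Residual Summit.BirchSwinnertonDyer.Rank1Residual.X11b

namespace Summit.BirchSwinnertonDyer.Rank1Residual.JET

/-! ## §1 Road S (bucket A, `p ≥ 5`) ⟸ named print only -/

/-- **Road S re-keyed: `bsdp_of_jetRowA5_tam_min` with every class-free binder except {PT, F1, Gross 3.7 (2),
GZK, Kolyvagin, modularity} FED BY NAME.** Numeric front-end VERBATIM (minimality, three Serre Prop-19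
witnesses ⇒ `ρ̄_{E,p}` onto, `TamLocal` certificate at the carrier `q ≠ p`, `w ≤ ord_p c`); consumer
`JET.bsdp_of_carrierNeCertificate_level_of_five_le_of_swapLiterature`. Displayed: `hPT`, `hF1`, `h372`,
`hGZK`, `hKo`, `hmod` + the row's Heegner/index/analytic data. CONDITIONAL on every binder; per pair.
[cite: Jetchev2008, Cor. 1.5 (p. 812)] [cite: Serre1972, §2.8 Prop. 19 and §5.2 (iii)] [cite: SilvermanATAEC1994, IV.9.4] -/
theorem bsdp_of_jetRowA5_tam_min_of_swapLiterature (p : ℕ) (hp : p.Prime) (hp5 : 5 ≤ p) (a1 a2 a3 a4 a6 : ℤ)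
    (hmin : (⟨a1, a2, a3, a4, a6⟩ : WeierstrassCurve ℚ).IsGloballyMinimal)
    (ℓ₁ ℓ₂ ℓ₃ : ℕ) (hℓ₁ : ℓ₁.Prime) (hℓ₂ : ℓ₂.Prime) (hℓ₃ : ℓ₃.Prime)
    (h2₁ : ℓ₁ ≠ 2) (h2₂ : ℓ₂ ≠ 2) (h2₃ : ℓ₃ ≠ 2) (hne₁ : ℓ₁ ≠ p) (hne₂ : ℓ₂ ≠ p) (hne₃ : ℓ₃ ≠ p)
    (hΔ₁ : ¬ (ℓ₁ : ℤ) ∣ discOf [a1, a2, a3, a4, a6]) (hΔ₂ : ¬ (ℓ₂ : ℤ) ∣ discOf [a1, a2, a3, a4, a6])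
    (hΔ₃ : ¬ (ℓ₃ : ℤ) ∣ discOf [a1, a2, a3, a4, a6])
    {n₁ n₂ n₃ : ℕ} (hc₁ : countPoints [a1, a2, a3, a4, a6] ℓ₁ = n₁)
    (hc₂ : countPoints [a1, a2, a3, a4, a6] ℓ₂ = n₂) (hc₃ : countPoints [a1, a2, a3, a4, a6] ℓ₃ = n₃)
    (r u : ZMod p)
    (hi : (((ℓ₁ : ℤ) + 1 - n₁ : ℤ) : ZMod p) ^ 2 - 4 * ℓ₁ = r * r ∧
      (((ℓ₁ : ℤ) + 1 - n₁ : ℤ) : ZMod p) ^ 2 - 4 * ℓ₁ ≠ 0 ∧ (((ℓ₁ : ℤ) + 1 - n₁ : ℤ) : ZMod p) ≠ 0)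
    (hii : ((((ℓ₂ : ℤ) + 1 - n₂ : ℤ) : ZMod p) ^ 2 - 4 * ℓ₂) ^ (p / 2) = -1 ∧
      (((ℓ₂ : ℤ) + 1 - n₂ : ℤ) : ZMod p) ≠ 0)
    (hiii : (((ℓ₃ : ℤ) + 1 - n₃ : ℤ) : ZMod p) ^ 2 = u * ℓ₃ ∧
      u ≠ 0 ∧ u ≠ 1 ∧ u ≠ 2 ∧ u ≠ 4 ∧ u ^ 2 - 3 * u + 1 ≠ 0)
    (q : ℕ) (T : TamLocal) (hTq : T.p = q) (hT : T.check ⟨a1, a2, a3, a4, a6⟩ = true)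
    {c : ℕ} (hvals : T.vals = [c]) {w : ℕ} (hw : w ≤ padicValNat p c) (hqp : q ≠ p)
    (hPT : ∀ (K : Type) [Field K] [NumberField K], poitouTate_selmerStructure_duality_conj K)
    (hF1 : Gross1991_heegnerPoint_sub_ratTorsion_mem_E0)
    (h372 : GrossLMS1991.prop37_2_frobeniusCongruence)
    (hGZK : rank_eq_analyticRank_of_analyticRank_le_one)
    (hKo : ∀ (N : ℕ) [NeZero N] (W : WeierstrassCurve ℚ) (K : Type) [Field K] [NumberField K], kolyvagin N W K)
    (hmod : exists_isNewformOf)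
    (W : WeierstrassCurve ℚ) (hW : W = ⟨a1, a2, a3, a4, a6⟩)
    {N : ℕ} [NeZero N] {K : Type} [Field K] [NumberField K] (hK : IsImaginaryQuadratic K)
    (hD3 : NumberField.discr K ≠ -3) (hD4 : NumberField.discr K ≠ -4)
    (hH : SatisfiesHeegnerHypothesis N K) {P : (W.baseChange K).toAffine.Point}
    (hP : IsHeegnerPoint N W K P) (hnt : ¬ IsOfFinAddOrder P) (hqN : q ∣ N)
    (hv : padicValNat p (AddSubgroup.zmultiples P).index ≤ w)
    (hr : W.analyticRank ≤ 1) {s : ℚ} (hs : shaAn W = (s : ℂ)) (hvs : padicValRat p s = 0) :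
    BSDp W p := by
  subst hW
  have h0 : discOf [a1, a2, a3, a4, a6] ≠ 0 := fun h ↦ hΔ₁ (by rw [h]; exact dvd_zero _)
  haveI hE : (⟨a1, a2, a3, a4, a6⟩ : WeierstrassCurve ℚ).IsElliptic :=
    X11b.isElliptic_of_discOf_ne_zero a1 a2 a3 a4 a6 h0
  haveI := hmin
  haveI : Fact (Nat.Prime p) := ⟨hp⟩
  haveI : Fact (Nat.Prime q) := ⟨hTq ▸ (TamLocal.check_common hT).1⟩
  have hI0 : integralModelInt (⟨a1, a2, a3, a4, a6⟩ : WeierstrassCurve ℚ) = ⟨a1, a2, a3, a4, a6⟩ :=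
    integralModelInt_eq_of_map_eq _ (map_mk_int a1 a2 a3 a4 a6)
  -- `ρ̄_{E,p}` onto from the three Serre witnesses (Serre 1972 Prop. 19)
  have hρ : Surj (⟨a1, a2, a3, a4, a6⟩ : WeierstrassCurve ℚ) p :=
    Supersingular.surj_of_ainvs_of_serreWitnesses a1 a2 a3 a4 a6 p hp5 hmin ℓ₁ ℓ₂ ℓ₃ hℓ₁ hℓ₂ hℓ₃
      h2₁ h2₂ h2₃ hne₁ hne₂ hne₃ hΔ₁ hΔ₂ hΔ₃ hc₁ hc₂ hc₃ r u hi hii hiii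
  -- the Tamagawa half in the kernel: `c_q(W/ℚ_q) = c`
  have hcq : ((⟨a1, a2, a3, a4, a6⟩ : WeierstrassCurve ℚ).baseChange ℚ_[q]).localTamagawaNumber ℤ_[q] = c :=
    Additive.IntModelTam.localTamagawaNumber_padic_eq_of_intModel_of_tamLocal hI0 q hTq hT hvals
  have hI : padicValNat p (AddSubgroup.zmultiples P).index ≤ padicValNat p
      (((⟨a1, a2, a3, a4, a6⟩ : WeierstrassCurve ℚ).baseChange ℚ_[q]).localTamagawaNumber ℤ_[q]) := hcq ▸ hv.trans hw
  exact bsdp_of_carrierNeCertificate_level_of_five_le_of_swapLiterature hPT hF1 h372 hGZK hKo hmod _ p hK hD3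
    hD4 hH hP hnt hp5 hρ q hqN hqp hI hr hs hvs

/-! ## §2 Bucket B, `p ≥ 5` multiplicative ⟸ named print only -/

/-- **`bsdp_of_jetRowB5_tam_min` re-keyed to named print only**: numeric front-end VERBATIM (minimality,
`p ∣ Δ`, `p ∤ c₄`, three Serre witnesses, `TamLocal` certificate AT `p`, `w ≤ ord_p c`); consumer
`JET.bsdp_of_carrierMultCertificate_level_of_surj_of_swapLiterature`. Displayed: `hPT`, `hF1`, `h372`, `hGZK`,
`hKo`, `hmod` + the row's data. CONDITIONAL on every binder; per pair. [cite: Jetchev2008, Cor. 1.5 (p. 812)]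
[cite: Serre1972, §2.8 Prop. 19 and §5.2 (iii)] [cite: SilvermanATAEC1994, IV.9.4] [cite: Wuthrich2014, Lemma 20 (p. 399)] -/
theorem bsdp_of_jetRowB5_tam_min_of_swapLiterature (p : ℕ) (hp : p.Prime) (hp5 : 5 ≤ p) (a1 a2 a3 a4 a6 : ℤ)
    (hmin : (⟨a1, a2, a3, a4, a6⟩ : WeierstrassCurve ℚ).IsGloballyMinimal)
    (hpΔ : (p : ℤ) ∣ (⟨a1, a2, a3, a4, a6⟩ : WeierstrassCurve ℤ).Δ)
    (hpc₄ : ¬ (p : ℤ) ∣ (⟨a1, a2, a3, a4, a6⟩ : WeierstrassCurve ℤ).c₄)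
    (ℓ₁ ℓ₂ ℓ₃ : ℕ) (hℓ₁ : ℓ₁.Prime) (hℓ₂ : ℓ₂.Prime) (hℓ₃ : ℓ₃.Prime)
    (h2₁ : ℓ₁ ≠ 2) (h2₂ : ℓ₂ ≠ 2) (h2₃ : ℓ₃ ≠ 2) (hne₁ : ℓ₁ ≠ p) (hne₂ : ℓ₂ ≠ p) (hne₃ : ℓ₃ ≠ p)
    (hΔ₁ : ¬ (ℓ₁ : ℤ) ∣ discOf [a1, a2, a3, a4, a6]) (hΔ₂ : ¬ (ℓ₂ : ℤ) ∣ discOf [a1, a2, a3, a4, a6])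
    (hΔ₃ : ¬ (ℓ₃ : ℤ) ∣ discOf [a1, a2, a3, a4, a6])
    {n₁ n₂ n₃ : ℕ} (hc₁ : countPoints [a1, a2, a3, a4, a6] ℓ₁ = n₁)
    (hc₂ : countPoints [a1, a2, a3, a4, a6] ℓ₂ = n₂) (hc₃ : countPoints [a1, a2, a3, a4, a6] ℓ₃ = n₃)
    (r u : ZMod p)
    (hi : (((ℓ₁ : ℤ) + 1 - n₁ : ℤ) : ZMod p) ^ 2 - 4 * ℓ₁ = r * r ∧
      (((ℓ₁ : ℤ) + 1 - n₁ : ℤ) : ZMod p) ^ 2 - 4 * ℓ₁ ≠ 0 ∧ (((ℓ₁ : ℤ) + 1 - n₁ : ℤ) : ZMod p) ≠ 0)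
    (hii : ((((ℓ₂ : ℤ) + 1 - n₂ : ℤ) : ZMod p) ^ 2 - 4 * ℓ₂) ^ (p / 2) = -1 ∧
      (((ℓ₂ : ℤ) + 1 - n₂ : ℤ) : ZMod p) ≠ 0)
    (hiii : (((ℓ₃ : ℤ) + 1 - n₃ : ℤ) : ZMod p) ^ 2 = u * ℓ₃ ∧
      u ≠ 0 ∧ u ≠ 1 ∧ u ≠ 2 ∧ u ≠ 4 ∧ u ^ 2 - 3 * u + 1 ≠ 0)
    (T : TamLocal) (hTp : T.p = p) (hT : T.check ⟨a1, a2, a3, a4, a6⟩ = true)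
    {c : ℕ} (hvals : T.vals = [c]) {w : ℕ} (hw : w ≤ padicValNat p c)
    (hPT : ∀ (K : Type) [Field K] [NumberField K], poitouTate_selmerStructure_duality_conj K)
    (hF1 : Gross1991_heegnerPoint_sub_ratTorsion_mem_E0)
    (h372 : GrossLMS1991.prop37_2_frobeniusCongruence)
    (hGZK : rank_eq_analyticRank_of_analyticRank_le_one)
    (hKo : ∀ (N : ℕ) [NeZero N] (W : WeierstrassCurve ℚ) (K : Type) [Field K] [NumberField K], kolyvagin N W K)
    (hmod : exists_isNewformOf)
    (W : WeierstrassCurve ℚ) (hW : W = ⟨a1, a2, a3, a4, a6⟩)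
    {N : ℕ} [NeZero N] {K : Type} [Field K] [NumberField K] (hK : IsImaginaryQuadratic K)
    (hD3 : NumberField.discr K ≠ -3) (hD4 : NumberField.discr K ≠ -4)
    (hH : SatisfiesHeegnerHypothesis N K) {P : (W.baseChange K).toAffine.Point}
    (hP : IsHeegnerPoint N W K P) (hnt : ¬ IsOfFinAddOrder P)
    (hv : padicValNat p (AddSubgroup.zmultiples P).index ≤ w)
    (hr : W.analyticRank ≤ 1) {s : ℚ} (hs : shaAn W = (s : ℂ)) (hvs : padicValRat p s = 0) :
    BSDp W p := by
  subst hW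
  have h0 : discOf [a1, a2, a3, a4, a6] ≠ 0 := fun h ↦ hΔ₁ (by rw [h]; exact dvd_zero _)
  haveI hE : (⟨a1, a2, a3, a4, a6⟩ : WeierstrassCurve ℚ).IsElliptic :=
    X11b.isElliptic_of_discOf_ne_zero a1 a2 a3 a4 a6 h0
  haveI := hmin
  haveI : Fact (Nat.Prime p) := ⟨hp⟩
  have hI0 : integralModelInt (⟨a1, a2, a3, a4, a6⟩ : WeierstrassCurve ℚ) = ⟨a1, a2, a3, a4, a6⟩ :=
    integralModelInt_eq_of_map_eq _ (map_mk_int a1 a2 a3 a4 a6)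
  -- `ρ̄_{E,p}` onto from the three Serre witnesses (Serre 1972 Prop. 19)
  have hρ : Surj (⟨a1, a2, a3, a4, a6⟩ : WeierstrassCurve ℚ) p :=
    Supersingular.surj_of_ainvs_of_serreWitnesses a1 a2 a3 a4 a6 p hp5 hmin ℓ₁ ℓ₂ ℓ₃ hℓ₁ hℓ₂ hℓ₃
      h2₁ h2₂ h2₃ hne₁ hne₂ hne₃ hΔ₁ hΔ₂ hΔ₃ hc₁ hc₂ hc₃ r u hi hii hiii
  -- multiplicative at the carrier `p`
  have hmult : (⟨a1, a2, a3, a4, a6⟩ : WeierstrassCurve ℚ).HasMultiplicativeReductionAtPrime p :=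
    hasMultiplicativeReductionAtPrime_of_intModel hI0 p hpΔ hpc₄
  -- the Tamagawa half in the kernel: `c_p(W/ℚ_p) = c`
  have hcp : ((⟨a1, a2, a3, a4, a6⟩ : WeierstrassCurve ℚ).baseChange ℚ_[p]).localTamagawaNumber ℤ_[p] = c :=
    Additive.IntModelTam.localTamagawaNumber_padic_eq_of_intModel_of_tamLocal hI0 p hTp hT hvals
  have hI : padicValNat p (AddSubgroup.zmultiples P).index ≤ padicValNat p
      (((⟨a1, a2, a3, a4, a6⟩ : WeierstrassCurve ℚ).baseChange ℚ_[p]).localTamagawaNumber ℤ_[p]) := hcp ▸ hv.trans hw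
  exact bsdp_of_carrierMultCertificate_level_of_surj_of_swapLiterature hPT hF1 h372 hGZK hKo hmod _ p hK hD3
    hD4 hH hP hnt (by omega) hmult hρ hI hr hs hvs

/-! ## §3 The desks' parse sample: ONE landed row re-derived through the re-keyed kit -/

/-- **`BSD(E,11)` for `127050cx1` ⟸ named print only** — the landed record `JET.bsdpJ_127050cx1_11`
(`JET/JetDocstrikeARecords01.lean`; register cell `(127050cx1, 11)`, row `JET@p∣N` bucket A, road S; model
`[1, 0, 1, -17543551, -28549647502]`, carrier `q = 3` with `c_q = 11`, Serre witnesses `13, 17, 13`,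
displayed index line `ord_11 [E(K):ℤP] ≤ 1`; REGISTER DATUM OF RECORD `K = ℚ(√-479)`, `ord_11 I_K = 1`,
NOT re-computed here) with its arguments VERBATIM, through `bsdp_of_jetRowA5_tam_min_of_swapLiterature`:
the displayed class-free binders are now {`hPT`, `hF1`, `h372`, `hGZK`, `hKo`, `hmod`} instead of {`hJ`
(READING), `hMcU`, `hGZK`, `hKo`, `hrec`, `hD36`, `hlev`}. CONDITIONAL on every binder; per cell; nothing
booked by this file. [cite: Jetchev2008, Thm. 1.4 and Cor. 1.5 (p. 812)] [cite: Serre1972, §2] [cite: Cremona2006, Table 1 (label 127050cx1)] -/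
theorem bsdpJ_127050cx1_11_of_swapLiterature
    (hPT : ∀ (K : Type) [Field K] [NumberField K], poitouTate_selmerStructure_duality_conj K)
    (hF1 : Gross1991_heegnerPoint_sub_ratTorsion_mem_E0)
    (h372 : GrossLMS1991.prop37_2_frobeniusCongruence)
    (hGZK : rank_eq_analyticRank_of_analyticRank_le_one)
    (hKo : ∀ (N : ℕ) [NeZero N] (W : WeierstrassCurve ℚ) (K : Type) [Field K] [NumberField K], kolyvagin N W K)
    (hmod : exists_isNewformOf)
    (W : WeierstrassCurve ℚ) (hW : W = ⟨1, 0, 1, -17543551, -28549647502⟩)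
    {N : ℕ} [NeZero N] {K : Type} [Field K] [NumberField K] (hK : IsImaginaryQuadratic K)
    (hD3 : NumberField.discr K ≠ -3) (hD4 : NumberField.discr K ≠ -4)
    (hH : SatisfiesHeegnerHypothesis N K) {P : (W.baseChange K).toAffine.Point}
    (hP : IsHeegnerPoint N W K P) (hnt : ¬ IsOfFinAddOrder P) (hqN : 3 ∣ N)
    (hv : padicValNat 11 (AddSubgroup.zmultiples P).index ≤ 1)
    (hr : W.analyticRank ≤ 1) {s : ℚ} (hs : shaAn W = (s : ℂ)) (hvs : padicValRat 11 s = 0) : BSDp W 11 :=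
  bsdp_of_jetRowA5_tam_min_of_swapLiterature 11 (by norm_num) (by norm_num) 1 0 1 (-17543551) (-28549647502)
    (Supersingular.isGloballyMinimal_of_krausCriterion₃_factored 1 0 1 (-17543551) (-28549647502) [(2, 5), (3, 11), (5, 6), (7, 3), (11, 8)] (by decide +kernel)
      (by intro t ht; fin_cases ht <;> norm_num) (by decide +kernel))
    13 17 13 (by norm_num) (by norm_num) (by norm_num) (by decide) (by decide) (by decide) (by decide) (by decide)
    (by decide) (by decide +kernel) (by decide +kernel) (by decide +kernel) (n₁ := 17) (n₂ := 20) (n₃ := 17)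
    (by decide +kernel) (by decide +kernel) (by decide +kernel) (1 : ZMod 11) (10 : ZMod 11) (by decide +kernel)
    (by decide +kernel) (by decide +kernel)
    3 ⟨3, 1, 1, 0, 0, 0, 0, 11, 0, 0, 11⟩ rfl (by decide +kernel) (c := 11) (by decide +kernel) (w := 1) (by decide +kernel) (by decide)
    hPT hF1 h372 hGZK hKo hmod W hW hK hD3 hD4 hH hP hnt hqN hv hr hs hvs

end Summit.BirchSwinnertonDyer.Rank1Residual.JET

end
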